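import Summits.BirchSwinnertonDyer.BirchSwinnertonDyer.Theorems.ResidualThetaTransportAtTwoThetaLayerLambdaCongruenceAtTwoHeckeAdjointHermite
import HarnessLib

/-!
# Crux `ThetaLayerLambdaCongruenceAtTwo` (stmt-BirchSwinnertonDyer-20688, route ResidualThetaTransportAtTwo), line
# `birth` v14 — SD floor, kernel road, Hecke clause of IP, brick HA8b (part 1) «SWEEP REPRESENTATIVES»: the set
# `S_p(N) = {A ∈ M₂(ℤ) : det A = p, N ∣ A₁₀, gcd(A₀₀, N) = 1}` (= `Γ₀(N)·diag(1,p)·Γ₀(N)`) is swept bijectively by `(j, u) ↦ u·(1 j; 0 p)`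
# [`⊔ u·(p 0; 0 1)` if `p ∤ N`] AND by `(j, u) ↦ (1 0; Nj p)·u` [`⊔ (p 0; 0 1)·u`], `u ∈ Γ₀(N)` (lead prover bsd-wall-rtt-p3 g13;
# `--supports stmt-BirchSwinnertonDyer-20688 --as helper`; closes nothing)

HONEST FRAMING. Elementary THEOREMS about `2×2` integer matrices (Hermite normal form inside `Γ₀(N)` and an involutive anti-automorphism);
no definition; nothing about any curve or form is asserted; BSD is not proved by any of this.

WHY (memo `Cruxes/ThetaLayerLambdaCongruenceAtTwo/Lines/birth-sd2-hecke-adjoint.md` §3 (C)–(D), «double-coset sweep»). In the proof of the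
Hecke clause `B (T_p • x) y = B x (T♯_p y)` both sides reduce to a sum over the SAME set of integer matrices — the dual side as
`Σ_i Σᶠ_{u ∈ Γ₀(N)} J(u⁻¹·M_i)` over the right-coset representatives `M_i ∈ {(1 j; 0 p)} [∪ {(p 0; 0 1)}]` of `T_p`/`U_p`, the Manin side as
`Σ_j Σᶠ_{u ∈ Γ₀(N)} J(adj(M̃_j)·u⁻¹)` over the transposed representatives `M̃_j = w_N (1 j; 0 p) w_N⁻¹ = (p 0; −Nj 1)`,
`adj(M̃_j) = (1 0; Nj p)`. THIS FILE proves that both parametrisations are BIJECTIONS onto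
`S_p(N) = {det = p, N ∣ A₁₀, IsCoprime A₀₀ N}`: §1 the LEFT one (existence: the Hermite normal form of `…HeckeAdjointHermite` lands in `Γ₀(N)`
because `N ∣ A₁₀`, and the representative `(p 0; 0 1)` occurs only when `p ∤ N` since `p ∣ A₀₀` is excluded by `IsCoprime A₀₀ N` otherwise;
uniqueness: `sl2_mul_hermite_unique`); §2 the RIGHT one, transported from §1 by the involutive ANTI-automorphism
`ψ(A) = w_N⁻¹·adj(A)·w_N = (a, c/N; Nb, d)` of `S_p(N)` (`ψ(XY) = ψ(Y)ψ(X)`, `ψψ = id`, `ψ(Γ₀(N)) = Γ₀(N)`, `ψ(1 j; 0 p) = (1 0; Nj p)`,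
`ψ(p 0; 0 1) = (p 0; 0 1)`). Part 2 (`…HeckeAdjointSweep`) turns the two bijections into the equality of the two `Σ Σᶠ`.

References: [Shimura1971] §3.3, Prop. 3.36 (`Γ₀(N) α Γ₀(N) = {det = p, N ∣ c, (a, N) = 1}` and its right cosets); [DiamondShurman2005] §5.2
(pp. 170–171, the representatives `β_j = (1 j; 0 p)`, `β_∞ = (p 0; 0 1)`); [Merel1994] §1.2 (transposed Hecke representatives).
-/

set_option autoImplicit false

noncomputable section

-- justification: the `Summit.BirchSwinnertonDyer.BirchSwinnertonDyer.…` path repeats a component (route-file convention)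
set_option linter.dupNamespace false

open scoped Classical MatrixGroups

open CongruenceSubgroup Matrix.SpecialLinearGroup ModularGroup
open Literature.NumberTheory.EllipticCurves.ModularForms

namespace Summit.BirchSwinnertonDyer.BirchSwinnertonDyer.Theorems.ThetaLayerLambdaCongruenceAtTwo

/-! ## §1. The left sweep: `S_p(N) = ⊔_j Γ₀(N)·(1 j; 0 p) [⊔ Γ₀(N)·(p 0; 0 1)]` -/

section LeftSweep

variable {N : ℕ} {p : ℕ}

/-- Entries of `u·(1 j; 0 p)`: `(u₀₀, j u₀₀ + p u₀₁; u₁₀, j u₁₀ + p u₁₁)`. [folklore] -/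
theorem mul_tpB_entries (u : Matrix (Fin 2) (Fin 2) ℤ) (j : ℤ) (p' : ℤ) :
    (u * !![1, j; 0, p']) 0 0 = u 0 0 ∧ (u * !![1, j; 0, p']) 0 1 = j * u 0 0 + p' * u 0 1 ∧
    (u * !![1, j; 0, p']) 1 0 = u 1 0 ∧ (u * !![1, j; 0, p']) 1 1 = j * u 1 0 + p' * u 1 1 := by
  refine ⟨?_, ?_, ?_, ?_⟩ <;> simp [Matrix.mul_apply, Fin.sum_univ_two] <;> ring

/-- Entries of `u·(p 0; 0 1)`: `(p u₀₀, u₀₁; p u₁₀, u₁₁)`. [folklore] -/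
theorem mul_tpD_entries (u : Matrix (Fin 2) (Fin 2) ℤ) (p' : ℤ) :
    (u * !![p', 0; 0, 1]) 0 0 = p' * u 0 0 ∧ (u * !![p', 0; 0, 1]) 0 1 = u 0 1 ∧
    (u * !![p', 0; 0, 1]) 1 0 = p' * u 1 0 ∧ (u * !![p', 0; 0, 1]) 1 1 = u 1 1 := by
  refine ⟨?_, ?_, ?_, ?_⟩ <;> simp [Matrix.mul_apply, Fin.sum_univ_two] <;> ring

/-- `N` divides the lower-left entry of `u ∈ Γ₀(N)`. [folklore] -/
theorem dvd_apply_one_zero (u : Gamma0 N) : (N : ℤ) ∣ (u : SL(2, ℤ)) 1 0 :=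
  (ZMod.intCast_zmod_eq_zero_iff_dvd _ N).mp (Gamma0_mem.mp u.2)

/-- The upper-left entry of `u ∈ Γ₀(N)` is coprime to `N` (`u₀₀u₁₁ − u₀₁u₁₀ = 1` with `N ∣ u₁₀`). [folklore] -/
theorem isCoprime_apply_zero_zero (u : Gamma0 N) : IsCoprime (((u : SL(2, ℤ)) : Matrix (Fin 2) (Fin 2) ℤ) 0 0) (N : ℤ) := by
  obtain ⟨c', hc'⟩ := dvd_apply_one_zero u
  have hdet : (u : SL(2, ℤ)) 0 0 * (u : SL(2, ℤ)) 1 1 - (u : SL(2, ℤ)) 0 1 * (u : SL(2, ℤ)) 1 0 = 1 := by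
    have := Matrix.det_fin_two ((u : SL(2, ℤ)) : Matrix (Fin 2) (Fin 2) ℤ)
    rw [(u : SL(2, ℤ)).2] at this
    linear_combination -this
  refine ⟨(u : SL(2, ℤ)) 1 1, -((u : SL(2, ℤ)) 0 1 * c'), ?_⟩
  rw [hc'] at hdet
  linear_combination hdet

/-- **Membership of the left cosets.** For `u ∈ Γ₀(N)` and any `j`: `u·(1 j; 0 p) ∈ S_p(N)`. [cite: Shimura1971, Prop. 3.36] -/
theorem gamma0_mul_tpB_mem (u : Gamma0 N) (j : ℤ) :
    (((u : SL(2, ℤ)) : Matrix (Fin 2) (Fin 2) ℤ) * !![1, j; 0, (p : ℤ)]).det = p ∧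
    (N : ℤ) ∣ (((u : SL(2, ℤ)) : Matrix (Fin 2) (Fin 2) ℤ) * !![1, j; 0, (p : ℤ)]) 1 0 ∧
    IsCoprime ((((u : SL(2, ℤ)) : Matrix (Fin 2) (Fin 2) ℤ) * !![1, j; 0, (p : ℤ)]) 0 0) (N : ℤ) := by
  obtain ⟨e00, -, e10, -⟩ := mul_tpB_entries ((u : SL(2, ℤ)) : Matrix (Fin 2) (Fin 2) ℤ) j p
  refine ⟨?_, ?_, ?_⟩
  · rw [Matrix.det_mul, Matrix.SpecialLinearGroup.det_coe, one_mul, Matrix.det_fin_two_of]; ring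
  · rw [e10]
    exact dvd_apply_one_zero u
  · rw [e00]; exact isCoprime_apply_zero_zero u

/-- **Membership of the extra left coset** (`p ∤ N`): `u·(p 0; 0 1) ∈ S_p(N)`. [cite: Shimura1971, Prop. 3.36] -/
theorem gamma0_mul_tpD_mem (u : Gamma0 N) (hp : p.Prime) (hpN : ¬ p ∣ N) :
    (((u : SL(2, ℤ)) : Matrix (Fin 2) (Fin 2) ℤ) * !![(p : ℤ), 0; 0, 1]).det = p ∧
    (N : ℤ) ∣ (((u : SL(2, ℤ)) : Matrix (Fin 2) (Fin 2) ℤ) * !![(p : ℤ), 0; 0, 1]) 1 0 ∧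
    IsCoprime ((((u : SL(2, ℤ)) : Matrix (Fin 2) (Fin 2) ℤ) * !![(p : ℤ), 0; 0, 1]) 0 0) (N : ℤ) := by
  obtain ⟨e00, -, e10, -⟩ := mul_tpD_entries ((u : SL(2, ℤ)) : Matrix (Fin 2) (Fin 2) ℤ) p
  refine ⟨?_, ?_, ?_⟩
  · rw [Matrix.det_mul, Matrix.SpecialLinearGroup.det_coe, one_mul, Matrix.det_fin_two_of]; ring
  · rw [e10]
    exact Dvd.dvd.mul_left (dvd_apply_one_zero u) _
  · rw [e00]
    exact IsCoprime.mul_left (Nat.isCoprime_iff_coprime.mpr ((Nat.Prime.coprime_iff_not_dvd hp).mpr hpN))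
      (isCoprime_apply_zero_zero u)

/-- **The left sweep is onto `S_p(N)`.** Every integer matrix `A` with `det A = p`, `N ∣ A₁₀` and `gcd(A₀₀, N) = 1` is `u·(1 j; 0 p)` for some
`u ∈ Γ₀(N)` and `0 ≤ j < p`, or — only when `p ∤ N` — `u·(p 0; 0 1)` for some `u ∈ Γ₀(N)` (Hermite normal form: the diagonal of the normal
form is `(1, p)` or `(p, 1)`; in the second case `p ∣ A₀₀`, impossible if `p ∣ N`). [cite: Shimura1971, Prop. 3.36] [cite: DiamondShurman2005, §5.2] -/
theorem exists_gamma0_mul_rep (hp : p.Prime) (A : Matrix (Fin 2) (Fin 2) ℤ) (hdet : A.det = p) (hc : (N : ℤ) ∣ A 1 0)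
    (ha : IsCoprime (A 0 0) (N : ℤ)) :
    ∃ u : Gamma0 N, (∃ j : Fin p, A = ((u : SL(2, ℤ)) : Matrix (Fin 2) (Fin 2) ℤ) * !![1, ((j : ℕ) : ℤ); 0, (p : ℤ)]) ∨
      (¬ p ∣ N ∧ A = ((u : SL(2, ℤ)) : Matrix (Fin 2) (Fin 2) ℤ) * !![(p : ℤ), 0; 0, 1]) := by
  have hpos : 0 < A.det := by rw [hdet]; exact_mod_cast hp.pos
  obtain ⟨v, h10, h11, h01, h01'⟩ := exists_sl2_mul_hermite A hpos
  set H := (v : Matrix (Fin 2) (Fin 2) ℤ) * A with hH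
  have hdetH : H 0 0 * H 1 1 = p := by
    have e : H.det = A.det := by rw [hH, Matrix.det_mul, Matrix.SpecialLinearGroup.det_coe, one_mul]
    rw [Matrix.det_fin_two, h10, mul_zero, sub_zero, hdet] at e
    exact e
  have hA : A = ((v⁻¹ : SL(2, ℤ)) : Matrix (Fin 2) (Fin 2) ℤ) * H := by
    rw [hH, ← Matrix.mul_assoc, ← coe_mul, inv_mul_cancel, Matrix.SpecialLinearGroup.coe_one, Matrix.one_mul]
  -- the lower-left entry of `u = v⁻¹` is `A₁₀ / H₀₀`
  have hu10 : A 1 0 = (v⁻¹ : SL(2, ℤ)) 1 0 * H 0 0 := by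
    conv_lhs => rw [hA]
    simp [Matrix.mul_apply, Fin.sum_univ_two, h10]
  have hu00 : A 0 0 = (v⁻¹ : SL(2, ℤ)) 0 0 * H 0 0 := by
    conv_lhs => rw [hA]
    simp [Matrix.mul_apply, Fin.sum_univ_two, h10]
  -- `H₁₁ ∈ {1, p}`
  have hdvd : H 1 1 ∣ (p : ℤ) := ⟨H 0 0, by rw [mul_comm]; exact hdetH.symm⟩
  have h11cases : H 1 1 = 1 ∨ H 1 1 = p := by
    have hn : (H 1 1).natAbs ∣ p := by
      have := Int.natAbs_dvd_natAbs.mpr hdvd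
      simpa using this
    rcases hp.eq_one_or_self_of_dvd _ hn with h | h
    · left; rw [← Int.natAbs_of_nonneg h11.le, h, Nat.cast_one]
    · right; rw [← Int.natAbs_of_nonneg h11.le, h]
  rcases h11cases with h1 | hP
  · -- `H = (p 0; 0 1)`, only if `p ∤ N`
    have h00 : H 0 0 = p := by rw [h1, mul_one] at hdetH; exact hdetH
    have h01z : H 0 1 = 0 := by rw [h1] at h01'; omega
    have hHeq : H = !![(p : ℤ), 0; 0, 1] := by
      ext i j; fin_cases i <;> fin_cases j <;> simp [h00, h01z, h10, h1]
    have hpN' : IsCoprime (p : ℤ) (N : ℤ) := by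
      rw [hu00, h00, mul_comm] at ha
      exact IsCoprime.of_mul_left_left ha
    have hpN : ¬ p ∣ N := by
      intro hd
      have h1' : IsUnit (p : ℤ) := IsCoprime.isUnit_of_dvd' hpN' (dvd_refl _) (Int.natCast_dvd_natCast.mpr hd)
      rw [Int.isUnit_iff_natAbs_eq, Int.natAbs_natCast] at h1'
      exact hp.one_lt.ne' h1'
    have hmem : (v⁻¹ : SL(2, ℤ)) ∈ Gamma0 N := by
      refine Gamma0_mem.mpr ((ZMod.intCast_zmod_eq_zero_iff_dvd _ N).mpr
        (IsCoprime.dvd_of_dvd_mul_left (IsCoprime.symm hpN') ?_))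
      rw [hu10, h00, mul_comm] at hc
      exact hc
    exact ⟨⟨v⁻¹, hmem⟩, Or.inr ⟨hpN, by rw [hA, hHeq]⟩⟩
  · -- `H = (1 j; 0 p)`
    have h00 : H 0 0 = 1 := by
      rw [hP] at hdetH
      have hp0 : (p : ℤ) ≠ 0 := by exact_mod_cast hp.ne_zero
      refine mul_right_cancel₀ hp0 ?_
      rw [one_mul]
      exact hdetH
    have hmem : (v⁻¹ : SL(2, ℤ)) ∈ Gamma0 N := by
      refine Gamma0_mem.mpr ((ZMod.intCast_zmod_eq_zero_iff_dvd _ N).mpr ?_)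
      rw [hu10, h00, mul_one] at hc
      exact hc
    refine ⟨⟨v⁻¹, hmem⟩, Or.inl ⟨⟨(H 0 1).toNat, ?_⟩, ?_⟩⟩
    · have : ((H 0 1).toNat : ℤ) < p := by rw [Int.toNat_of_nonneg h01, ← hP]; exact h01'
      exact_mod_cast this
    · have hj : (((H 0 1).toNat : ℕ) : ℤ) = H 0 1 := Int.toNat_of_nonneg h01
      have hHeq : H = !![1, (((H 0 1).toNat : ℕ) : ℤ); 0, (p : ℤ)] := by
        ext i j; fin_cases i <;> fin_cases j <;> simp [h00, hj, h10, hP]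
      rw [hA, ← hHeq]

/-- The representatives `(1 j; 0 p)` (`0 ≤ j < p`) and `(p 0; 0 1)` are in Hermite normal form: `v·A` equal to one of them satisfies the four
conditions of `sl2_mul_hermite_unique`. [folklore] -/
theorem hermite_conditions_of_eq {v : SL(2, ℤ)} {A : Matrix (Fin 2) (Fin 2) ℤ} {a b d : ℤ}
    (h : (v : Matrix (Fin 2) (Fin 2) ℤ) * A = !![a, b; 0, d]) (hd : 0 < d) (hb : 0 ≤ b) (hbd : b < d) :
    ((v : Matrix (Fin 2) (Fin 2) ℤ) * A) 1 0 = 0 ∧ 0 < ((v : Matrix (Fin 2) (Fin 2) ℤ) * A) 1 1 ∧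
      0 ≤ ((v : Matrix (Fin 2) (Fin 2) ℤ) * A) 0 1 ∧ ((v : Matrix (Fin 2) (Fin 2) ℤ) * A) 0 1 < ((v : Matrix (Fin 2) (Fin 2) ℤ) * A) 1 1 := by
  rw [h]; simp [hd, hb, hbd]

/-- **The left sweep is injective** (Hermite uniqueness): `u·(1 j; 0 p) = u'·(1 j'; 0 p)` with `0 ≤ j, j' < p` forces `u = u'` and `j = j'`.
[cite: Shimura1971, Prop. 3.36] -/
theorem mul_tpB_inj (hp : p.Prime) {u u' : SL(2, ℤ)} {j j' : Fin p}
    (h : (u : Matrix (Fin 2) (Fin 2) ℤ) * !![1, ((j : ℕ) : ℤ); 0, (p : ℤ)] = (u' : Matrix (Fin 2) (Fin 2) ℤ) * !![1, ((j' : ℕ) : ℤ); 0, (p : ℤ)]) :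
    u = u' ∧ j = j' := by
  set A := (u : Matrix (Fin 2) (Fin 2) ℤ) * !![1, ((j : ℕ) : ℤ); 0, (p : ℤ)] with hAdef
  have hdet : 0 < A.det := by
    rw [hAdef, Matrix.det_mul, Matrix.SpecialLinearGroup.det_coe, one_mul, Matrix.det_fin_two_of]
    simp [hp.pos]
  have hv : ((u⁻¹ : SL(2, ℤ)) : Matrix (Fin 2) (Fin 2) ℤ) * A = !![1, ((j : ℕ) : ℤ); 0, (p : ℤ)] := by
    rw [hAdef, ← Matrix.mul_assoc, ← coe_mul, inv_mul_cancel, Matrix.SpecialLinearGroup.coe_one, Matrix.one_mul]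
  have hv' : ((u'⁻¹ : SL(2, ℤ)) : Matrix (Fin 2) (Fin 2) ℤ) * A = !![1, ((j' : ℕ) : ℤ); 0, (p : ℤ)] := by
    rw [h, ← Matrix.mul_assoc, ← coe_mul, inv_mul_cancel, Matrix.SpecialLinearGroup.coe_one, Matrix.one_mul]
  have hp0 : (0 : ℤ) < p := by exact_mod_cast hp.pos
  obtain ⟨a1, a2, a3, a4⟩ := hermite_conditions_of_eq hv hp0 (by positivity) (by exact_mod_cast j.2)
  obtain ⟨b1, b2, b3, b4⟩ := hermite_conditions_of_eq hv' hp0 (by positivity) (by exact_mod_cast j'.2)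
  have huu : u⁻¹ = u'⁻¹ := sl2_mul_hermite_unique A hdet _ _ a1 a2 a3 a4 b1 b2 b3 b4
  have hu : u = u' := inv_injective huu
  refine ⟨hu, ?_⟩
  rw [hu] at hv
  have e := hv.symm.trans hv'
  have e01 := congrArg (fun X : Matrix (Fin 2) (Fin 2) ℤ ↦ X 0 1) e
  simp only [Matrix.of_apply, Matrix.cons_val', Matrix.cons_val_zero, Matrix.cons_val_one, Matrix.empty_val',
    Matrix.cons_val_fin_one, Nat.cast_inj] at e01
  exact Fin.ext e01

/-- **The two kinds of left cosets are disjoint**: `u·(1 j; 0 p) ≠ u'·(p 0; 0 1)` (`p` prime). [cite: Shimura1971, Prop. 3.36] -/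
theorem mul_tpB_ne_mul_tpD (hp : p.Prime) (u u' : SL(2, ℤ)) (j : Fin p) :
    (u : Matrix (Fin 2) (Fin 2) ℤ) * !![1, ((j : ℕ) : ℤ); 0, (p : ℤ)] ≠ (u' : Matrix (Fin 2) (Fin 2) ℤ) * !![(p : ℤ), 0; 0, 1] := by
  intro h
  set A := (u : Matrix (Fin 2) (Fin 2) ℤ) * !![1, ((j : ℕ) : ℤ); 0, (p : ℤ)] with hAdef
  have hdet : 0 < A.det := by
    rw [hAdef, Matrix.det_mul, Matrix.SpecialLinearGroup.det_coe, one_mul, Matrix.det_fin_two_of]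
    simp [hp.pos]
  have hv : ((u⁻¹ : SL(2, ℤ)) : Matrix (Fin 2) (Fin 2) ℤ) * A = !![1, ((j : ℕ) : ℤ); 0, (p : ℤ)] := by
    rw [hAdef, ← Matrix.mul_assoc, ← coe_mul, inv_mul_cancel, Matrix.SpecialLinearGroup.coe_one, Matrix.one_mul]
  have hv' : ((u'⁻¹ : SL(2, ℤ)) : Matrix (Fin 2) (Fin 2) ℤ) * A = !![(p : ℤ), 0; 0, 1] := by
    rw [h, ← Matrix.mul_assoc, ← coe_mul, inv_mul_cancel, Matrix.SpecialLinearGroup.coe_one, Matrix.one_mul]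
  have hp0 : (0 : ℤ) < p := by exact_mod_cast hp.pos
  obtain ⟨a1, a2, a3, a4⟩ := hermite_conditions_of_eq hv hp0 (by positivity) (by exact_mod_cast j.2)
  obtain ⟨b1, b2, b3, b4⟩ := hermite_conditions_of_eq hv' one_pos le_rfl one_pos
  have huu : u⁻¹ = u'⁻¹ := sl2_mul_hermite_unique A hdet _ _ a1 a2 a3 a4 b1 b2 b3 b4
  rw [huu] at hv
  have e := hv.symm.trans hv'
  have e00 := congrArg (fun X : Matrix (Fin 2) (Fin 2) ℤ ↦ X 0 0) e
  simp only [Matrix.of_apply, Matrix.cons_val', Matrix.cons_val_zero, Matrix.empty_val', Matrix.cons_val_fin_one] at e00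
  have : (p : ℤ) = 1 := e00.symm
  exact hp.one_lt.ne' (by exact_mod_cast this)

/-- **Injectivity of the extra left coset**: `u·(p 0; 0 1) = u'·(p 0; 0 1) ⇒ u = u'`. [folklore] -/
theorem mul_tpD_inj (hp : p.Prime) {u u' : SL(2, ℤ)}
    (h : (u : Matrix (Fin 2) (Fin 2) ℤ) * !![(p : ℤ), 0; 0, 1] = (u' : Matrix (Fin 2) (Fin 2) ℤ) * !![(p : ℤ), 0; 0, 1]) : u = u' := by
  set A := (u : Matrix (Fin 2) (Fin 2) ℤ) * !![(p : ℤ), 0; 0, 1] with hAdef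
  have hdet : 0 < A.det := by
    rw [hAdef, Matrix.det_mul, Matrix.SpecialLinearGroup.det_coe, one_mul, Matrix.det_fin_two_of]
    simp [hp.pos]
  have hv : ((u⁻¹ : SL(2, ℤ)) : Matrix (Fin 2) (Fin 2) ℤ) * A = !![(p : ℤ), 0; 0, 1] := by
    rw [hAdef, ← Matrix.mul_assoc, ← coe_mul, inv_mul_cancel, Matrix.SpecialLinearGroup.coe_one, Matrix.one_mul]
  have hv' : ((u'⁻¹ : SL(2, ℤ)) : Matrix (Fin 2) (Fin 2) ℤ) * A = !![(p : ℤ), 0; 0, 1] := by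
    rw [h, ← Matrix.mul_assoc, ← coe_mul, inv_mul_cancel, Matrix.SpecialLinearGroup.coe_one, Matrix.one_mul]
  obtain ⟨a1, a2, a3, a4⟩ := hermite_conditions_of_eq hv one_pos le_rfl one_pos
  obtain ⟨b1, b2, b3, b4⟩ := hermite_conditions_of_eq hv' one_pos le_rfl one_pos
  exact inv_injective (sl2_mul_hermite_unique A hdet _ _ a1 a2 a3 a4 b1 b2 b3 b4)

end LeftSweep

/-! ## §2. The anti-automorphism `ψ(A) = w_N⁻¹ adj(A) w_N = (a, c/N; Nb, d)` and the right sweep -/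

section RightSweep

variable {N : ℕ} [NeZero N] {p : ℕ}

/-- `ψ(A) = (a, c/N; Nb, d)` computed from an exact quotient `c = N c₀`. [folklore] -/
theorem psi_eq_of_apply_one_zero (A : Matrix (Fin 2) (Fin 2) ℤ) (c₀ : ℤ) (hc : A 1 0 = (N : ℤ) * c₀) :
    (!![A 0 0, A 1 0 / (N : ℤ); (N : ℤ) * A 0 1, A 1 1] : Matrix (Fin 2) (Fin 2) ℤ) = !![A 0 0, c₀; (N : ℤ) * A 0 1, A 1 1] := by
  have hN : (N : ℤ) ≠ 0 := by exact_mod_cast NeZero.ne N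
  rw [hc, Int.mul_ediv_cancel_left _ hN]

/-- **`ψ` is an ANTI-automorphism**: `ψ(AB) = ψ(B)ψ(A)` for integer matrices with `N ∣ A₁₀`, `N ∣ B₁₀` (conjugation of `adj` by `w_N`).
[folklore] -/
theorem psi_mul (A B : Matrix (Fin 2) (Fin 2) ℤ) (hA : (N : ℤ) ∣ A 1 0) (hB : (N : ℤ) ∣ B 1 0) :
    (!![(A * B) 0 0, (A * B) 1 0 / (N : ℤ); (N : ℤ) * (A * B) 0 1, (A * B) 1 1] : Matrix (Fin 2) (Fin 2) ℤ) =
      !![B 0 0, B 1 0 / (N : ℤ); (N : ℤ) * B 0 1, B 1 1] * !![A 0 0, A 1 0 / (N : ℤ); (N : ℤ) * A 0 1, A 1 1] := by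
  obtain ⟨a₀, ha₀⟩ := hA
  obtain ⟨b₀, hb₀⟩ := hB
  have hAB : (A * B) 1 0 = (N : ℤ) * (a₀ * B 0 0 + A 1 1 * b₀) := by
    simp only [Matrix.mul_apply, Fin.sum_univ_two, ha₀, hb₀]; ring
  rw [psi_eq_of_apply_one_zero (A * B) _ hAB, psi_eq_of_apply_one_zero A a₀ ha₀, psi_eq_of_apply_one_zero B b₀ hb₀]
  ext i j
  fin_cases i <;> fin_cases j <;> simp [Matrix.mul_apply, Fin.sum_univ_two, ha₀, hb₀] <;> ring

/-- **`ψ` is an involution** on matrices with `N ∣ A₁₀`. [folklore] -/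
theorem psi_psi (A : Matrix (Fin 2) (Fin 2) ℤ) (hA : (N : ℤ) ∣ A 1 0) :
    (!![(!![A 0 0, A 1 0 / (N : ℤ); (N : ℤ) * A 0 1, A 1 1] : Matrix (Fin 2) (Fin 2) ℤ) 0 0,
        (!![A 0 0, A 1 0 / (N : ℤ); (N : ℤ) * A 0 1, A 1 1] : Matrix (Fin 2) (Fin 2) ℤ) 1 0 / (N : ℤ);
        (N : ℤ) * (!![A 0 0, A 1 0 / (N : ℤ); (N : ℤ) * A 0 1, A 1 1] : Matrix (Fin 2) (Fin 2) ℤ) 0 1,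
        (!![A 0 0, A 1 0 / (N : ℤ); (N : ℤ) * A 0 1, A 1 1] : Matrix (Fin 2) (Fin 2) ℤ) 1 1] : Matrix (Fin 2) (Fin 2) ℤ) = A := by
  have hN : (N : ℤ) ≠ 0 := by exact_mod_cast NeZero.ne N
  obtain ⟨a₀, ha₀⟩ := hA
  ext i j
  fin_cases i <;> fin_cases j <;> simp [ha₀, Int.mul_ediv_cancel_left _ hN]

/-- `ψ` maps `Γ₀(N)` to `Γ₀(N)`: for `u ∈ Γ₀(N)` the matrix `ψ(u) = (u₀₀, u₁₀/N; N u₀₁, u₁₁)` is again in `Γ₀(N)` (it is `w_N⁻¹ u⁻¹ w_N`).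
[folklore] -/
theorem exists_gamma0_coe_eq_psi (u : Gamma0 N) :
    ∃ u' : Gamma0 N, ((u' : SL(2, ℤ)) : Matrix (Fin 2) (Fin 2) ℤ) =
      !![(u : SL(2, ℤ)) 0 0, (u : SL(2, ℤ)) 1 0 / (N : ℤ); (N : ℤ) * (u : SL(2, ℤ)) 0 1, (u : SL(2, ℤ)) 1 1] := by
  have hN : (N : ℤ) ≠ 0 := by exact_mod_cast NeZero.ne N
  obtain ⟨c₀, hc₀⟩ := dvd_apply_one_zero u
  have hdet : (u : SL(2, ℤ)) 0 0 * (u : SL(2, ℤ)) 1 1 - (u : SL(2, ℤ)) 0 1 * (u : SL(2, ℤ)) 1 0 = 1 := by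
    have := Matrix.det_fin_two ((u : SL(2, ℤ)) : Matrix (Fin 2) (Fin 2) ℤ)
    rw [(u : SL(2, ℤ)).2] at this
    linear_combination -this
  have hdet' : Matrix.det !![(u : SL(2, ℤ)) 0 0, c₀; (N : ℤ) * (u : SL(2, ℤ)) 0 1, (u : SL(2, ℤ)) 1 1] = 1 := by
    rw [Matrix.det_fin_two_of]
    rw [hc₀] at hdet
    linear_combination hdet
  refine ⟨⟨⟨_, hdet'⟩, Gamma0_mem.mpr ((ZMod.intCast_zmod_eq_zero_iff_dvd _ N).mpr ⟨(u : SL(2, ℤ)) 0 1, ?_⟩)⟩, ?_⟩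
  · simp
  · change (!![(u : SL(2, ℤ)) 0 0, c₀; (N : ℤ) * (u : SL(2, ℤ)) 0 1, (u : SL(2, ℤ)) 1 1] : Matrix (Fin 2) (Fin 2) ℤ) = _
    rw [hc₀, Int.mul_ediv_cancel_left _ hN]

omit [NeZero N] in
/-- `ψ(1 j; 0 p) = (1 0; Nj p)` and `ψ(p 0; 0 1) = (p 0; 0 1)`. [folklore] -/
theorem psi_tpB_tpD (j p' : ℤ) :
    (!![(!![1, j; 0, p'] : Matrix (Fin 2) (Fin 2) ℤ) 0 0, (!![1, j; 0, p'] : Matrix (Fin 2) (Fin 2) ℤ) 1 0 / (N : ℤ);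
        (N : ℤ) * (!![1, j; 0, p'] : Matrix (Fin 2) (Fin 2) ℤ) 0 1, (!![1, j; 0, p'] : Matrix (Fin 2) (Fin 2) ℤ) 1 1]
        : Matrix (Fin 2) (Fin 2) ℤ) = !![1, 0; (N : ℤ) * j, p'] ∧
    (!![(!![p', 0; 0, 1] : Matrix (Fin 2) (Fin 2) ℤ) 0 0, (!![p', 0; 0, 1] : Matrix (Fin 2) (Fin 2) ℤ) 1 0 / (N : ℤ);
        (N : ℤ) * (!![p', 0; 0, 1] : Matrix (Fin 2) (Fin 2) ℤ) 0 1, (!![p', 0; 0, 1] : Matrix (Fin 2) (Fin 2) ℤ) 1 1]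
        : Matrix (Fin 2) (Fin 2) ℤ) = !![p', 0; 0, 1] := by
  constructor <;> (ext i j; fin_cases i <;> fin_cases j <;> simp)

/-- **The right sweep is onto `S_p(N)`.** Every `A` with `det A = p`, `N ∣ A₁₀`, `gcd(A₀₀, N) = 1` is `(1 0; Nj p)·u` for some `u ∈ Γ₀(N)`,
`0 ≤ j < p`, or — only when `p ∤ N` — `(p 0; 0 1)·u` (apply the left sweep to `ψ(A)` and pull back with the anti-involution `ψ`).
[cite: Shimura1971, Prop. 3.36] [cite: Merel1994, §1.2] -/
theorem exists_rep_mul_gamma0 (hp : p.Prime) (A : Matrix (Fin 2) (Fin 2) ℤ) (hdet : A.det = p) (hc : (N : ℤ) ∣ A 1 0)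
    (ha : IsCoprime (A 0 0) (N : ℤ)) :
    ∃ u : Gamma0 N, (∃ j : Fin p, A = !![1, 0; (N : ℤ) * ((j : ℕ) : ℤ), (p : ℤ)] * ((u : SL(2, ℤ)) : Matrix (Fin 2) (Fin 2) ℤ)) ∨
      (¬ p ∣ N ∧ A = !![(p : ℤ), 0; 0, 1] * ((u : SL(2, ℤ)) : Matrix (Fin 2) (Fin 2) ℤ)) := by
  have hN : (N : ℤ) ≠ 0 := by exact_mod_cast NeZero.ne N
  obtain ⟨c₀, hc₀⟩ := hc
  -- `ψ(A) ∈ S_p(N)`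
  set A' : Matrix (Fin 2) (Fin 2) ℤ := !![A 0 0, c₀; (N : ℤ) * A 0 1, A 1 1] with hA'
  have hdet' : A'.det = p := by
    rw [hA', Matrix.det_fin_two_of, ← hdet, Matrix.det_fin_two, hc₀]; ring
  have hc' : (N : ℤ) ∣ A' 1 0 := ⟨A 0 1, by simp [hA']⟩
  have ha' : IsCoprime (A' 0 0) (N : ℤ) := by simpa [hA'] using ha
  obtain ⟨u, hu⟩ := exists_gamma0_mul_rep hp A' hdet' hc' ha'
  obtain ⟨u', hu'⟩ := exists_gamma0_coe_eq_psi u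
  -- pull back: `A = ψ(ψ A) = ψ(u·M) = ψ(M)·ψ(u)`
  have hback : A = !![A' 0 0, A' 1 0 / (N : ℤ); (N : ℤ) * A' 0 1, A' 1 1] := by
    have e := psi_psi A ⟨c₀, hc₀⟩
    rw [psi_eq_of_apply_one_zero A c₀ hc₀] at e
    exact e.symm
  refine ⟨u', ?_⟩
  rcases hu with ⟨j, hj⟩ | ⟨hpN, hD⟩
  · refine Or.inl ⟨j, ?_⟩
    rw [hback, hj, psi_mul _ _ (dvd_apply_one_zero u) ⟨0, by simp⟩, (psi_tpB_tpD (N := N) _ _).1, hu']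
  · refine Or.inr ⟨hpN, ?_⟩
    rw [hback, hD, psi_mul _ _ (dvd_apply_one_zero u) ⟨0, by simp⟩, (psi_tpB_tpD (N := N) 0 _).2, hu']

/-- **The right sweep is injective**: `(1 0; Nj p)·u = (1 0; Nj' p)·u'` (`u, u' ∈ Γ₀(N)`, `0 ≤ j, j' < p`) forces `u = u'`, `j = j'`
(apply `ψ` and use `mul_tpB_inj`). [cite: Shimura1971, Prop. 3.36] -/
theorem lowB_mul_inj (hp : p.Prime) {u u' : Gamma0 N} {j j' : Fin p}
    (h : !![1, 0; (N : ℤ) * ((j : ℕ) : ℤ), (p : ℤ)] * ((u : SL(2, ℤ)) : Matrix (Fin 2) (Fin 2) ℤ) =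
      !![1, 0; (N : ℤ) * ((j' : ℕ) : ℤ), (p : ℤ)] * ((u' : SL(2, ℤ)) : Matrix (Fin 2) (Fin 2) ℤ)) :
    u = u' ∧ j = j' := by
  obtain ⟨v, hv⟩ := exists_gamma0_coe_eq_psi u
  obtain ⟨v', hv'⟩ := exists_gamma0_coe_eq_psi u'
  have hL : (!![1, 0; (N : ℤ) * ((j : ℕ) : ℤ), (p : ℤ)] : Matrix (Fin 2) (Fin 2) ℤ) 1 0 = (N : ℤ) * ((j : ℕ) : ℤ) := by simp
  have hL' : (!![1, 0; (N : ℤ) * ((j' : ℕ) : ℤ), (p : ℤ)] : Matrix (Fin 2) (Fin 2) ℤ) 1 0 = (N : ℤ) * ((j' : ℕ) : ℤ) := by simp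
  have e := congrArg (fun X : Matrix (Fin 2) (Fin 2) ℤ ↦ (!![X 0 0, X 1 0 / (N : ℤ); (N : ℤ) * X 0 1, X 1 1] : Matrix (Fin 2) (Fin 2) ℤ)) h
  rw [psi_mul _ _ ⟨_, hL⟩ (dvd_apply_one_zero u), psi_mul _ _ ⟨_, hL'⟩ (dvd_apply_one_zero u'), ← hv, ← hv',
    psi_eq_of_apply_one_zero _ _ hL, psi_eq_of_apply_one_zero _ _ hL'] at e
  have e' : ((v : SL(2, ℤ)) : Matrix (Fin 2) (Fin 2) ℤ) * !![1, ((j : ℕ) : ℤ); 0, (p : ℤ)] =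
      ((v' : SL(2, ℤ)) : Matrix (Fin 2) (Fin 2) ℤ) * !![1, ((j' : ℕ) : ℤ); 0, (p : ℤ)] := by
    convert e using 2 <;> (ext i k; fin_cases i <;> fin_cases k <;> simp)
  obtain ⟨hvv, hjj⟩ := mul_tpB_inj hp e'
  refine ⟨?_, hjj⟩
  -- `ψ` is injective on `Γ₀(N)`: `u = ψ(ψ u)`
  have hu := psi_psi ((u : SL(2, ℤ)) : Matrix (Fin 2) (Fin 2) ℤ) (dvd_apply_one_zero u)
  have hu' := psi_psi ((u' : SL(2, ℤ)) : Matrix (Fin 2) (Fin 2) ℤ) (dvd_apply_one_zero u')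
  rw [← hv] at hu
  rw [← hv'] at hu'
  have hvv' : ((v : SL(2, ℤ)) : Matrix (Fin 2) (Fin 2) ℤ) = ((v' : SL(2, ℤ)) : Matrix (Fin 2) (Fin 2) ℤ) := by rw [hvv]
  rw [hvv'] at hu
  exact Subtype.ext (Subtype.ext (hu.symm.trans hu'))

end RightSweep

end Summit.BirchSwinnertonDyer.BirchSwinnertonDyer.Theorems.ThetaLayerLambdaCongruenceAtTwo

end
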